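import Summits.AnomalousDissipation.AnomalousDissipation.Theorems.SolenoidalFractalHomogenisationLagrangianStepSidebandXDefsFrame
import Summits.AnomalousDissipation.AnomalousDissipation.Theorems.SolenoidalFractalHomogenisationLagrangianStepSidebandResponseExtFrame
import Summits.AnomalousDissipation.AnomalousDissipation.Theorems.SolenoidalFractalHomogenisationLagrangianStepSidebandXEnergyDefs
import HarnessLib

/-!
# K1L_D `LagrangianRenormalisationStepDesign` (stmt-AnomalousDissipation-27980), registered stub `stub_D1_V0thg` (v28, D28-3 (3)/D28-6/D28-7), port-map layer L5:
# the TWISTED reference state, residual and outside-tail energy of the box-truncated sideband vector of a frozen-frame weak solution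
# (shared definitions; reviewed; `--kind definition --supports stmt-AnomalousDissipation-27980 --as helper`)

Summits-side DEFINITIONS file of route `SolenoidalFractalHomogenisation` (prover seat `ad-k1l-cellLawV-w1` g9; road of record D28-7 = port map §3 L5).  Frozen-frame twin of
`…SidebandXEnergyDefs`: `refStateθ` (`Σⱼ ξⱼ • Nθⱼ t (xθ t)`, `Nθⱼ = responseExtθ W₁ 𝔸 G₀ 1 R j`, `xθ t = modeRepθ … G₀ … ℓ t`), `residualXθ` (`Zθ t − projXθ (yθ t)`),
`tailEnergyθ` (twisted representatives outside the box); unfolding lemmas and `tailEnergyθ_nonneg`.  `xiCoeff`, `slotAmp`, `classFreq`, `box` are the flat ones.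
NOT a proof of anything; rung F-D1.A0 infrastructure.  AD is not proved.
-/

set_option linter.dupNamespace false

noncomputable section

namespace Summit.AnomalousDissipation.AnomalousDissipation.Theorems.SolenoidalFractalHomogenisation.LagrangianStep.Sideband

open Set MeasureTheory Complex UnitAddTorus
open scoped InnerProductSpace
open Literature.Analysis Literature.Analysis.FunctionSpaces Literature.Analysis.FunctionSpaces.Torus
open Literature.Analysis.FluidPDE Literature.Analysis.FluidPDE.Torus Literature.Analysis.FluidPDE.LatticeShear
open Summit.AnomalousDissipation.AnomalousDissipation.Theorems.SolenoidalFractalHomogenisation.LagrangianStep.CellChain (modeRepθ)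

variable {k₀ : ℕ}

/-! ## §1 The reference state and the residual -/

/-- **The reference state** `y t = Σⱼ ξⱼ • Nⱼ t (x t)` (`Nⱼ = responseExtθ W₁ 𝔸 G₀ 1 R j`, `x t = modeRep … ℓ t` for `𝔹 = (1/n²)•𝔸`).
[cite: SandersVerhulstMurdock2007, Lemma 5.2.7 (linear case)] [cite: MajdaKramer1999, §2.2.1.3 (cell problem (49))] -/
def refStateθ (W₁ : LatticeWord k₀) (n : ℕ) (ℓ : Fin 3 → ℤ) (𝔸 : Torus.Visc4 (Fin 3)) (G₀ : Matrix (Fin 3) (Fin 3) ℝ) (R : ℕ)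
    (F : UnitAddTorus (Fin 3) → EuclideanSpace ℝ (Fin 3)) (w : ℝ → UnitAddTorus (Fin 3) → EuclideanSpace ℝ (Fin 3)) (t : ℝ) : Space R :=
  ∑ j, ((xiCoeff W₁ n ℓ j : ℝ) : ℂ) • responseExtθ W₁ 𝔸 G₀ 1 R j t (modeRepθ W₁ n ((1 / (n : ℝ) ^ 2) • 𝔸) G₀ F w ℓ t)

/-- Unfolding `refState`. [cite: SandersVerhulstMurdock2007, Lemma 5.2.7 (linear case)] -/
theorem refStateθ_def (W₁ : LatticeWord k₀) (n : ℕ) (ℓ : Fin 3 → ℤ) (𝔸 : Torus.Visc4 (Fin 3)) (G₀ : Matrix (Fin 3) (Fin 3) ℝ) (R : ℕ)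
    (F : UnitAddTorus (Fin 3) → EuclideanSpace ℝ (Fin 3)) (w : ℝ → UnitAddTorus (Fin 3) → EuclideanSpace ℝ (Fin 3)) (t : ℝ) :
    refStateθ W₁ n ℓ 𝔸 G₀ R F w t =
      ∑ j, ((xiCoeff W₁ n ℓ j : ℝ) : ℂ) • responseExtθ W₁ 𝔸 G₀ 1 R j t (modeRepθ W₁ n ((1 / (n : ℝ) ^ 2) • 𝔸) G₀ F w ℓ t) := rfl

/-- **The residual** `r t = Z t − projXθ n ℓ G₀ R (y t)` of the box-truncated sideband vector of the weak solution against the class-transversal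
reference. [cite: SandersVerhulstMurdock2007, Lemma 5.2.7 (linear case)] [cite: MajdaKramer1999, §2.2.1.3 (cell problem (49))] -/
def residualXθ (W₁ : LatticeWord k₀) (n : ℕ) (ℓ : Fin 3 → ℤ) (𝔸 : Torus.Visc4 (Fin 3)) (G₀ : Matrix (Fin 3) (Fin 3) ℝ) (R : ℕ)
    (F : UnitAddTorus (Fin 3) → EuclideanSpace ℝ (Fin 3)) (w : ℝ → UnitAddTorus (Fin 3) → EuclideanSpace ℝ (Fin 3)) (t : ℝ) : Space R :=
  sbVecθ W₁ n ((1 / (n : ℝ) ^ 2) • 𝔸) G₀ F w ℓ R t - projXθ n ℓ G₀ R (refStateθ W₁ n ℓ 𝔸 G₀ R F w t)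

/-- Unfolding `residualX` (as a function of time, in the shape of `…SidebandXResidual.hasDerivWithinAt_residual`).
[cite: SandersVerhulstMurdock2007, Lemma 5.2.7 (linear case)] -/
theorem residualXθ_eq (W₁ : LatticeWord k₀) (n : ℕ) (ℓ : Fin 3 → ℤ) (𝔸 : Torus.Visc4 (Fin 3)) (G₀ : Matrix (Fin 3) (Fin 3) ℝ) (R : ℕ)
    (F : UnitAddTorus (Fin 3) → EuclideanSpace ℝ (Fin 3)) (w : ℝ → UnitAddTorus (Fin 3) → EuclideanSpace ℝ (Fin 3)) :
    residualXθ W₁ n ℓ 𝔸 G₀ R F w = fun τ => sbVecθ W₁ n ((1 / (n : ℝ) ^ 2) • 𝔸) G₀ F w ℓ R τ -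
      projXθ n ℓ G₀ R (∑ j, ((xiCoeff W₁ n ℓ j : ℝ) : ℂ) • responseExtθ W₁ 𝔸 G₀ 1 R j τ (modeRepθ W₁ n ((1 / (n : ℝ) ^ 2) • 𝔸) G₀ F w ℓ τ)) := rfl

/-- Unfolding `residualX` at a time. [cite: SandersVerhulstMurdock2007, Lemma 5.2.7 (linear case)] -/
theorem residualXθ_apply (W₁ : LatticeWord k₀) (n : ℕ) (ℓ : Fin 3 → ℤ) (𝔸 : Torus.Visc4 (Fin 3)) (G₀ : Matrix (Fin 3) (Fin 3) ℝ) (R : ℕ)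
    (F : UnitAddTorus (Fin 3) → EuclideanSpace ℝ (Fin 3)) (w : ℝ → UnitAddTorus (Fin 3) → EuclideanSpace ℝ (Fin 3)) (t : ℝ) :
    residualXθ W₁ n ℓ 𝔸 G₀ R F w t = sbVecθ W₁ n ((1 / (n : ℝ) ^ 2) • 𝔸) G₀ F w ℓ R t - projXθ n ℓ G₀ R (refStateθ W₁ n ℓ 𝔸 G₀ R F w t) := rfl

/-! ## §2 The outside-tail energy -/

open Classical in
/-- **The outside-tail energy at time `t`**: `Σ_{z ∈ box} (Σⱼ ‖αⱼ‖(‖[z−mⱼ ∉ box ∪ {0}]·x(k_{z−mⱼ},t)‖ + ‖[z+mⱼ ∉ box ∪ {0}]·x(k_{z+mⱼ},t)‖))²`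
(only class modes OUTSIDE the box within `max|mⱼ|` of its boundary enter). [cite: MajdaKramer1999, §2.2.1.3 (cell problem (49))]
[cite: Temam1984, Ch. III §1 Lemma 1.2 (energy inequality)] -/
def tailEnergyθ (W₁ : LatticeWord k₀) (n : ℕ) (ℓ : Fin 3 → ℤ) (𝔸 : Torus.Visc4 (Fin 3)) (G₀ : Matrix (Fin 3) (Fin 3) ℝ) (R : ℕ)
    (F : UnitAddTorus (Fin 3) → EuclideanSpace ℝ (Fin 3)) (w : ℝ → UnitAddTorus (Fin 3) → EuclideanSpace ℝ (Fin 3)) (t : ℝ) : ℝ :=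
  ∑ z : box R, (∑ j, ‖slotAmp W₁ j‖ *
    (‖(if (z.1 - (W₁.phase j).m ∉ box R ∧ z.1 - (W₁.phase j).m ≠ 0) then
        modeRepθ W₁ n ((1 / (n : ℝ) ^ 2) • 𝔸) G₀ F w (classFreq n ℓ (z.1 - (W₁.phase j).m)) t else 0)‖ +
     ‖(if (z.1 + (W₁.phase j).m ∉ box R ∧ z.1 + (W₁.phase j).m ≠ 0) then
        modeRepθ W₁ n ((1 / (n : ℝ) ^ 2) • 𝔸) G₀ F w (classFreq n ℓ (z.1 + (W₁.phase j).m)) t else 0)‖)) ^ 2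

open Classical in
/-- Unfolding `tailEnergy`. [cite: MajdaKramer1999, §2.2.1.3 (cell problem (49))] -/
theorem tailEnergyθ_def (W₁ : LatticeWord k₀) (n : ℕ) (ℓ : Fin 3 → ℤ) (𝔸 : Torus.Visc4 (Fin 3)) (G₀ : Matrix (Fin 3) (Fin 3) ℝ) (R : ℕ)
    (F : UnitAddTorus (Fin 3) → EuclideanSpace ℝ (Fin 3)) (w : ℝ → UnitAddTorus (Fin 3) → EuclideanSpace ℝ (Fin 3)) (t : ℝ) :
    tailEnergyθ W₁ n ℓ 𝔸 G₀ R F w t =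
      ∑ z : box R, (∑ j, ‖slotAmp W₁ j‖ *
        (‖(if (z.1 - (W₁.phase j).m ∉ box R ∧ z.1 - (W₁.phase j).m ≠ 0) then
            modeRepθ W₁ n ((1 / (n : ℝ) ^ 2) • 𝔸) G₀ F w (classFreq n ℓ (z.1 - (W₁.phase j).m)) t else 0)‖ +
         ‖(if (z.1 + (W₁.phase j).m ∉ box R ∧ z.1 + (W₁.phase j).m ≠ 0) then
            modeRepθ W₁ n ((1 / (n : ℝ) ^ 2) • 𝔸) G₀ F w (classFreq n ℓ (z.1 + (W₁.phase j).m)) t else 0)‖)) ^ 2 := rfl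

/-- The outside-tail energy is non-negative. [cite: MajdaKramer1999, §2.2.1.3 (cell problem (49))] -/
theorem tailEnergyθ_nonneg (W₁ : LatticeWord k₀) (n : ℕ) (ℓ : Fin 3 → ℤ) (𝔸 : Torus.Visc4 (Fin 3)) (G₀ : Matrix (Fin 3) (Fin 3) ℝ) (R : ℕ)
    (F : UnitAddTorus (Fin 3) → EuclideanSpace ℝ (Fin 3)) (w : ℝ → UnitAddTorus (Fin 3) → EuclideanSpace ℝ (Fin 3)) (t : ℝ) :
    0 ≤ tailEnergyθ W₁ n ℓ 𝔸 G₀ R F w t :=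
  Finset.sum_nonneg fun _ _ => sq_nonneg _

end Summit.AnomalousDissipation.AnomalousDissipation.Theorems.SolenoidalFractalHomogenisation.LagrangianStep.Sideband

end
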